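import Literature.NumberTheory.Automorphic.RestrictedTensorProductBoxInvariants
import Literature.NumberTheory.Automorphic.SmoothCharacter
import HarnessLib

/-!
# The box-level operator of a restricted pure tensor on a restricted tensor product: `π_{∏L}(⊗ fᵢ) ∘ j_S = j_S ∘ ⊗ᵢ ρᵢ,_{Lᵢ}(fᵢ)`

Topic `NumberTheory/Automorphic`; namespace `Literature.NumberTheory.Automorphic`.  Let `(W, π, j)` be a restricted tensor product
`π ≅ ⊗'_i (ρ i, x₀ i)` of complex representations of a restricted product `Πʳ i, [G i, K i]` (★ `IsRestrictedTensorProductRep`,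
[Flath1979 §2 Example 2; Bump1997 §3.4]), `S` a finite set of indices, `L i ≤ G i` subgroups with `L i`-fixed base vectors off `S`,
and `F` the RESTRICTED PURE TENSOR test function `F(g) = 1_{∀ i ∉ S, gᵢ ∈ Lᵢ} · ∏_{i ∈ S} fᵢ(gᵢ)` built from local functions `fᵢ`
which are right-`Lᵢ`-invariant with finite support modulo `Lᵢ` (`i ∈ S`).  The tree's finite-coset-sum operator
★ `Representation.levelAct μ K f v = μ(K) • ∑ᶠ_{q ∈ G/K} f(q̃) • π(q̃) v` ([Bump1997 §4.2]; ★ `SmoothCharacter`) then satisfies, on the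
values `j (extend S m)` with `mᵢ ∈ Vᵢ^{Lᵢ}`,

  `π.levelAct μ (∏ L) F (j (extend S m)) = j (extend S (fun i => (ρ i).levelAct (μ i) (L i) (f i) (m i)))`

(`levelAct_boxSubgroup_extend`), provided the measures enter compatibly: `μ(∏ L i) = ∏_{i ∈ S} μᵢ(Lᵢ)` (Tate's product formula
for the restricted product measure with `μᵢ(Lᵢ) = μᵢ(Kᵢ) = 1` off `S`; here a HYPOTHESIS on one real number, so that no measure
theory is used).  The proof is the finite double count «cosets of `∏ Lᵢ` meeting the support of `F` ↔ `∏_{i∈S}` (cosets of `Lᵢ`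
meeting the support of `fᵢ`)» through the section `t ↦ (t̃ᵢ)_{i∈S} × (1)_{i∉S}`, the right-`∏ L`-invariance of `g ↦ F(g) π(g) w`
for `w ∈ W^{∏ L}`, and the multilinearity of `m ↦ j (extend S m)` (`MultilinearMap.map_sum_finset`, `map_smul_univ`).  With
★ `RestrictedTensorProductBoxInvariants` (`W^{∏ L} ≅ ⨂_{i∈S} Vᵢ^{Lᵢ}`) this gives the trace product formula `tr π(F) = ∏ᵢ tr ρᵢ(fᵢ)`
(next file).  [CartierCorvallis1979 §IV.1 (4.4); Bump1997 §3.4 Thm. 3.4.4 ff.]  Theorems only; no instance, no notation, no `sorry`.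

## References
* D. Flath, *Decomposition of representations into tensor products*, Corvallis 1979, part 1, §2 Example 2 [Flath1979].
* P. Cartier, *Representations of p-adic groups: a survey*, Corvallis 1979, part 1, §IV.1 [CartierCorvallis1979].
* D. Bump, *Automorphic Forms and Representations* (1997), §3.4, §4.2 [Bump1997].
-/

open scoped RestrictedProduct TensorProduct
open Filter PiTensorProduct MeasureTheory

namespace Literature.NumberTheory.Automorphic

universe u uG v w

section BoxSection

variable {ι : Type u} {G : ι → Type uG} [∀ i, Group (G i)] {K : ∀ i, Subgroup (G i)} [DecidableEq ι]

/-! ### Elements with prescribed coordinates on `S` and `1` elsewhere -/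

/-- The family with coordinates `gᵢ` on the finite set `S` and `1` elsewhere is eventually in the `K i`. [cite: Flath1979, §2 Example 2] -/
theorem eventually_boxElt_mem (S : Finset ι) (g : ∀ i : S, G i) :
    ∀ᶠ i in cofinite, (fun i => if hi : i ∈ S then g ⟨i, hi⟩ else (1 : G i)) i ∈ (K i : Set (G i)) :=
  S.eventually_cofinite_notMem.mono fun i hi => by
    simp only [hi, ↓reduceDIte, SetLike.mem_coe, one_mem]

/-- Coordinates on `S` of the element with coordinates `gᵢ` on `S` and `1` elsewhere. [cite: Flath1979, §2 Example 2] -/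
theorem boxElt_apply_of_mem (S : Finset ι) (g : ∀ i : S, G i) {i : ι} (hi : i ∈ S) :
    (RestrictedProduct.mk (fun i => if hi : i ∈ S then g ⟨i, hi⟩ else (1 : G i)) (eventually_boxElt_mem (K := K) S g) :
      Πʳ i, [G i, K i]) i = g ⟨i, hi⟩ := by
  show (if hi : i ∈ S then g ⟨i, hi⟩ else (1 : G i)) = g ⟨i, hi⟩
  rw [dif_pos hi]

/-- Coordinates off `S` of the element with coordinates `gᵢ` on `S` and `1` elsewhere. [cite: Flath1979, §2 Example 2] -/
theorem boxElt_apply_of_not_mem (S : Finset ι) (g : ∀ i : S, G i) {i : ι} (hi : i ∉ S) :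
    (RestrictedProduct.mk (fun i => if hi : i ∈ S then g ⟨i, hi⟩ else (1 : G i)) (eventually_boxElt_mem (K := K) S g) :
      Πʳ i, [G i, K i]) i = 1 := by
  show (if hi : i ∈ S then g ⟨i, hi⟩ else (1 : G i)) = 1
  rw [dif_neg hi]

/-- **A section of `∏_{i∈S} (Gᵢ ⧸ Lᵢ) → (Πʳ Gᵢ) ⧸ ∏ Lᵢ` exists**: a map `sec` with coordinates `t̃ᵢ` (any representatives) on `S`
and `1` elsewhere; two values in the same coset of the box `∏ Lᵢ` have equal arguments. [cite: Flath1979, §2 Example 2] -/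
theorem exists_boxSection (S : Finset ι) (L : ∀ i, Subgroup (G i)) :
    ∃ sec : (∀ i : S, G i ⧸ L (i : ι)) → Πʳ i, [G i, K i],
      (∀ (t : ∀ i : S, G i ⧸ L (i : ι)) {i : ι} (hi : i ∈ S), sec t i = (t ⟨i, hi⟩).out) ∧
      (∀ (t : ∀ i : S, G i ⧸ L (i : ι)) {i : ι}, i ∉ S → sec t i = 1) ∧
      ∀ t t' : ∀ i : S, G i ⧸ L (i : ι),
        (QuotientGroup.mk (sec t) : _ ⧸ boxSubgroup (K := K) L) = QuotientGroup.mk (sec t') → t = t' := by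
  refine ⟨fun t => RestrictedProduct.mk (fun i => if hi : i ∈ S then (t ⟨i, hi⟩).out else (1 : G i))
      (eventually_boxElt_mem (K := K) S fun i => (t i).out),
    fun t i hi => boxElt_apply_of_mem S (fun i => (t i).out) hi,
    fun t i hi => boxElt_apply_of_not_mem S (fun i => (t i).out) hi, fun t t' h => ?_⟩
  rw [QuotientGroup.eq, mem_boxSubgroup_iff] at h
  funext i
  have hi := h i
  rw [RestrictedProduct.mul_apply, RestrictedProduct.inv_apply, boxElt_apply_of_mem S (fun i => (t i).out) i.2,
    boxElt_apply_of_mem S (fun i => (t' i).out) i.2] at hi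
  rw [← QuotientGroup.out_eq' (t i), ← QuotientGroup.out_eq' (t' i), QuotientGroup.eq]
  exact hi

end BoxSection

section LevelAct

variable {ι : Type u} {G : ι → Type uG} [∀ i, Group (G i)]
  {K : ∀ i, Subgroup (G i)} {V : ι → Type v} [∀ i, AddCommGroup (V i)] [∀ i, Module ℂ (V i)]
  {ρ : ∀ i, Representation ℂ (G i) (V i)} {x₀ : ∀ i, V i} [DecidableEq ι]
  {W : Type w} [AddCommGroup W] [Module ℂ W] {π : Representation ℂ (Πʳ i, [G i, K i]) W}
  {hx₀ : ∀ᶠ i in cofinite, x₀ i ∈ (ρ i).fixedPoints (K i)}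
  {j : RestrictedFamily V x₀ → W} {S₀ : Finset ι}

namespace IsRestrictedTensorProductRep

/-! ### The action of an element with trivial coordinates off `S` -/

/-- **An element with coordinates `1` off `S` acts slotwise on `j (extend S m)`**: it sends `j (extend S m)` to
`j (extend S (ρᵢ(gᵢ) mᵢ)ᵢ)` (equivariance of `j`; off `S` the base vectors are fixed by `1`). [cite: Flath1979, §2 Example 2] -/
theorem apply_extend_of_apply_eq_one_off (h : IsRestrictedTensorProductRep ρ π hx₀ j S₀) (S : Finset ι)
    (g : Πʳ i, [G i, K i]) (hg : ∀ i, i ∉ S → g i = 1) (m : ∀ i : S, V i) :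
    π g (j (RestrictedFamily.extend S m)) = j (RestrictedFamily.extend S fun i => ρ i (g i) (m i)) := by
  rw [← h.map_smul]
  congr 1
  ext i
  rw [RestrictedFamily.smul_apply]
  by_cases hi : i ∈ S
  · rw [RestrictedFamily.extend_apply_of_mem _ _ hi, RestrictedFamily.extend_apply_of_mem _ _ hi]
  · rw [hg i hi, RestrictedFamily.extend_apply_of_notMem _ _ hi, RestrictedFamily.extend_apply_of_notMem _ _ hi, map_one,
      Module.End.one_apply]

/-! ### The box-level operator of a restricted pure tensor -/

/-- **`π_{∏L}(F) ∘ j_S = j_S ∘ ⊗ᵢ ρᵢ,_{Lᵢ}(fᵢ)` on `W^{∏ L}`-generating vectors.**  Let `F(g) = 1_{∀ i ∉ S, gᵢ ∈ Lᵢ} · ∏_{i∈S} fᵢ(gᵢ)`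
(hypotheses `hF₁`, `hF₀`) with `fᵢ` right-`Lᵢ`-invariant of finite support modulo `Lᵢ` (`i ∈ S`), let the base vectors off `S` be
`Lᵢ`-fixed, and let `μ(∏ Lᵢ) = ∏_{i∈S} μᵢ(Lᵢ)`.  Then for `mᵢ ∈ Vᵢ^{Lᵢ}`:
`π.levelAct μ (∏ L) F (j (extend S m)) = j (extend S (fun i => (ρ i).levelAct (μ i) (L i) (f i) (m i)))` —
the finite coset sums on both sides are indexed by `∏_{i∈S} (Gᵢ ⧸ Lᵢ)` through the section `t ↦ (t̃ᵢ)_{i∈S} × 1`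
(`exists_boxSection`), and `j` is multilinear in the slots. [cite: Flath1979, §2 Example 2] [cite: CartierCorvallis1979, §IV.1]
[cite: Bump1997, §4.2; Thm. 3.4.4] -/
theorem levelAct_boxSubgroup_extend [∀ i, MeasurableSpace (G i)] [MeasurableSpace (Πʳ i, [G i, K i])]
    (h : IsRestrictedTensorProductRep ρ π hx₀ j S₀) (S : Finset ι)
    (L : ∀ i, Subgroup (G i)) (hx₀L : ∀ i, i ∉ S → x₀ i ∈ (ρ i).fixedPoints (L i))
    (f : ∀ i, G i → ℂ) (hfL : ∀ i : S, ∀ x ∈ L (i : ι), ∀ g : G i, f i (g * x) = f i g)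
    (hfin : ∀ i : S, (Function.support fun q : G i ⧸ L (i : ι) => f i q.out).Finite)
    (F : (Πʳ i, [G i, K i]) → ℂ) (hF₁ : ∀ g : Πʳ i, [G i, K i], (∀ i, i ∉ S → g i ∈ L i) → F g = ∏ i : S, f i (g i))
    (hF₀ : ∀ g : Πʳ i, [G i, K i], ¬ (∀ i, i ∉ S → g i ∈ L i) → F g = 0)
    (μ : Measure (Πʳ i, [G i, K i])) (μi : ∀ i, Measure (G i))
    (hμ : μ.real (boxSubgroup (K := K) L : Set (Πʳ i, [G i, K i])) = ∏ i : S, (μi i).real (L i : Set (G i)))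
    (m : ∀ i : S, V i) (hm : ∀ i : S, m i ∈ (ρ i).fixedPoints (L i)) :
    π.levelAct μ (boxSubgroup (K := K) L) F (j (RestrictedFamily.extend S m)) =
      j (RestrictedFamily.extend S fun i => (ρ i).levelAct (μi i) (L i) (f i) (m i)) := by
  classical
  -- the multilinear map `m ↦ j (extend S m)`
  have hM : ∀ m' : ∀ i : S, V i,
      j (RestrictedFamily.extend S m') = h.isRestrictedTensorProduct.isRestrictedMultilinear.restrictMultilinear S m' :=
    fun _ => rfl
  -- the local finite coset supports
  obtain ⟨T, hT⟩ : ∃ T : ∀ i : S, Finset (G i ⧸ L (i : ι)), ∀ (i : S) (q : G i ⧸ L (i : ι)), f i q.out ≠ 0 → q ∈ T i :=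
    ⟨fun i => (hfin i).toFinset, fun i q hq => (hfin i).mem_toFinset.2 hq⟩
  -- the section
  obtain ⟨sec, hsec₁, hsec₀, hsecinj⟩ := exists_boxSection (K := K) S L
  -- `w := j (extend S m)` is `∏ L`-fixed, so `g ↦ F g • π g w` is right-`∏ L`-invariant
  have hwB : j (RestrictedFamily.extend S m) ∈ π.fixedPoints (boxSubgroup (K := K) L) := by
    rw [hM]
    exact h.restrictMultilinear_mem_fixedPoints_boxSubgroup S L hx₀L m hm
  have hFB : ∀ b ∈ boxSubgroup (K := K) L, ∀ g : Πʳ i, [G i, K i], F (g * b) = F g := by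
    intro b hb g
    have hb' := (mem_boxSubgroup_iff (K := K)).1 hb
    by_cases hg : ∀ i, i ∉ S → g i ∈ L i
    · have hgb : ∀ i, i ∉ S → (g * b) i ∈ L i := fun i hi => by
        rw [RestrictedProduct.mul_apply]; exact (L i).mul_mem (hg i hi) (hb' i)
      rw [hF₁ _ hgb, hF₁ _ hg]
      refine Finset.prod_congr rfl fun i _ => ?_
      rw [RestrictedProduct.mul_apply]
      exact hfL i (b i) (hb' i) (g i)
    · have hgb : ¬ ∀ i, i ∉ S → (g * b) i ∈ L i := fun h' => hg fun i hi => by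
        have := (L i).mul_mem (h' i hi) ((L i).inv_mem (hb' i))
        rwa [RestrictedProduct.mul_apply, mul_inv_cancel_right] at this
      rw [hF₀ _ hgb, hF₀ _ hg]
  have hQB : ∀ b ∈ boxSubgroup (K := K) L, ∀ g : Πʳ i, [G i, K i],
      F (g * b) • π (g * b) (j (RestrictedFamily.extend S m)) = F g • π g (j (RestrictedFamily.extend S m)) := by
    intro b hb g
    rw [hFB b hb g, map_mul, Module.End.mul_apply, ((π.mem_fixedPoints _ _).1 hwB) b hb]
  -- the value of `F` on a section element
  have hFsec : ∀ t : ∀ i : S, G i ⧸ L (i : ι), F (sec t) = ∏ i : S, f i (t i).out := by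
    intro t
    rw [hF₁ (sec t) (fun i hi => by rw [hsec₀ t hi]; exact one_mem _)]
    exact Finset.prod_congr rfl fun i _ => by rw [hsec₁ t i.2]
  -- the support of `q ↦ F q̃ • π q̃ w` lies in the image of `∏ Tᵢ` under `t ↦ [sec t]`
  have hsupp : (Function.support fun q : (Πʳ i, [G i, K i]) ⧸ boxSubgroup (K := K) L =>
      F q.out • π q.out (j (RestrictedFamily.extend S m))) ⊆
      ((Fintype.piFinset T).image fun t => (QuotientGroup.mk (sec t) : _ ⧸ boxSubgroup (K := K) L) : Set _) := by
    intro q hq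
    rw [Function.mem_support] at hq
    have hFq : F q.out ≠ 0 := fun h0 => hq (by rw [h0, zero_smul])
    have hbox : ∀ i, i ∉ S → q.out i ∈ L i := by
      by_contra hc
      exact hFq (hF₀ _ hc)
    -- the candidate preimage `t` and the representatives' discrepancies
    have ht : ∀ i : S, ∃ l ∈ L (i : ι),
        ((QuotientGroup.mk (q.out (i : ι)) : G i ⧸ L (i : ι))).out = q.out (i : ι) * l := fun i => by
      obtain ⟨l, hl⟩ := QuotientGroup.mk_out_eq_mul (L (i : ι)) (q.out (i : ι))
      exact ⟨l, l.2, hl⟩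
    have hΨt : (QuotientGroup.mk (sec fun i : S => (QuotientGroup.mk (q.out (i : ι)) : G i ⧸ L (i : ι))) :
        _ ⧸ boxSubgroup (K := K) L) = q := by
      conv_rhs => rw [← QuotientGroup.out_eq' q]
      refine QuotientGroup.eq.2 ((mem_boxSubgroup_iff (K := K)).2 fun i => ?_)
      rw [RestrictedProduct.mul_apply, RestrictedProduct.inv_apply]
      by_cases hi : i ∈ S
      · obtain ⟨l, hl, hout⟩ := ht ⟨i, hi⟩
        rw [hsec₁ _ hi, hout, mul_inv_rev, mul_assoc]
        show l⁻¹ * ((q.out i)⁻¹ * q.out i) ∈ L i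
        rw [inv_mul_cancel, mul_one]
        exact (L i).inv_mem hl
      · rw [hsec₀ _ hi, inv_one, one_mul]
        exact hbox i hi
    refine Finset.mem_coe.2 (Finset.mem_image.2 ⟨_, Fintype.mem_piFinset.2 fun i => hT i _ ?_, hΨt⟩)
    obtain ⟨l, hl, hout⟩ := ht i
    rw [hout, hfL i l hl]
    intro h0
    apply hFq
    rw [hF₁ _ hbox]
    exact Finset.prod_eq_zero (Finset.mem_univ i) h0
  -- LEFT side as a sum over `∏ Tᵢ`
  have hLHS : π.levelAct μ (boxSubgroup (K := K) L) F (j (RestrictedFamily.extend S m)) =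
      (μ.real (boxSubgroup (K := K) L : Set (Πʳ i, [G i, K i])) : ℂ) •
        ∑ t ∈ Fintype.piFinset T, (∏ i : S, f i (t i).out) • π (sec t) (j (RestrictedFamily.extend S m)) := by
    rw [Representation.levelAct, finsum_eq_sum_of_support_subset _ hsupp,
      Finset.sum_image fun t _ t' _ htt' => hsecinj t t' htt']
    congr 1
    refine Finset.sum_congr rfl fun t _ => ?_
    obtain ⟨b, hb⟩ := QuotientGroup.mk_out_eq_mul (boxSubgroup (K := K) L) (sec t)
    rw [hb, hQB b b.2, hFsec]
  -- each section element acts slotwise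
  have hact : ∀ t : ∀ i : S, G i ⧸ L (i : ι), π (sec t) (j (RestrictedFamily.extend S m)) =
      j (RestrictedFamily.extend S fun i => ρ i (t i).out (m i)) := by
    intro t
    have hfun : (fun i : S => ρ (i : ι) ((sec t) (i : ι)) (m i)) = fun i : S => ρ (i : ι) (t i).out (m i) :=
      funext fun i => by rw [hsec₁ t i.2]
    rw [h.apply_extend_of_apply_eq_one_off S (sec t) (fun i hi => hsec₀ t hi) m, hfun]
  -- the RIGHT side: local sums over `Tᵢ`
  have hRHS : ∀ i : S, (ρ i).levelAct (μi i) (L i) (f i) (m i) =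
      ((μi i).real (L i : Set (G i)) : ℂ) • ∑ q ∈ T i, f i q.out • ρ i q.out (m i) := by
    intro i
    rw [Representation.levelAct, finsum_eq_sum_of_support_subset]
    intro q hq
    rw [Function.mem_support] at hq
    exact Finset.mem_coe.2 (hT i q fun h0 => hq (by rw [h0, zero_smul]))
  -- assemble by multilinearity
  calc π.levelAct μ (boxSubgroup (K := K) L) F (j (RestrictedFamily.extend S m))
      = (μ.real (boxSubgroup (K := K) L : Set (Πʳ i, [G i, K i])) : ℂ) •
          ∑ t ∈ Fintype.piFinset T, (∏ i : S, f i (t i).out) • π (sec t) (j (RestrictedFamily.extend S m)) := hLHS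
    _ = (∏ i : S, ((μi i).real (L i : Set (G i)) : ℂ)) •
          ∑ t ∈ Fintype.piFinset T, (∏ i : S, f i (t i).out) •
            h.isRestrictedTensorProduct.isRestrictedMultilinear.restrictMultilinear S (fun i => ρ i (t i).out (m i)) := by
        rw [hμ, Complex.ofReal_prod]
        congr 1
        refine Finset.sum_congr rfl fun t _ => ?_
        rw [hact t, hM]
    _ = (∏ i : S, ((μi i).real (L i : Set (G i)) : ℂ)) •
          ∑ t ∈ Fintype.piFinset T,
            h.isRestrictedTensorProduct.isRestrictedMultilinear.restrictMultilinear S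
              (fun i => f i (t i).out • ρ i (t i).out (m i)) := by
        congr 1
        refine Finset.sum_congr rfl fun t _ => ?_
        rw [MultilinearMap.map_smul_univ]
    _ = (∏ i : S, ((μi i).real (L i : Set (G i)) : ℂ)) •
          h.isRestrictedTensorProduct.isRestrictedMultilinear.restrictMultilinear S
            (fun i => ∑ q ∈ T i, f i q.out • ρ i q.out (m i)) := by
        rw [MultilinearMap.map_sum_finset]
    _ = h.isRestrictedTensorProduct.isRestrictedMultilinear.restrictMultilinear S
            (fun i => ((μi i).real (L i : Set (G i)) : ℂ) • ∑ q ∈ T i, f i q.out • ρ i q.out (m i)) := by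
        rw [MultilinearMap.map_smul_univ]
    _ = j (RestrictedFamily.extend S fun i => (ρ i).levelAct (μi i) (L i) (f i) (m i)) := by
        rw [hM]
        congr 1
        funext i
        rw [hRHS i]

end IsRestrictedTensorProductRep

end LevelAct

end Literature.NumberTheory.Automorphic
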